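import Literature.AnabelianGeometry.SemiGraphs.PSCSmoothCurveGenuineRankStatements
import Literature.AnabelianGeometry.SemiGraphs.PSCSmoothCurveGenuineRank
import Literature.AnabelianGeometry.SemiGraphs.ProSigmaCompletionSummand
import Literature.AnabelianGeometry.SemiGraphs.PSCCoveringDatumSturdyAt
import Literature.AnabelianGeometry.AbsoluteAnabelian.LocalReciprocityCofinal
import Literature.GroupTheory.CombinatorialGroupTheory.PuncturedSurfaceGroupAbelianizationBasis
import HarnessLib

/-!
# [CombGC] Rmk. 1.3.1, second claim (`CuspRank`): the rank of `M^cusp_G` at a genuine smooth curve is `r(G) − 1`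

Mochizuki, *A combinatorial version of the Grothendieck conjecture* [CombGC], Tohoku Math. J. **59**
(2007), Rmk. 1.3.1 p. 10: "if `G` has cusps, then the rank of `M^cusp_G` is equal to `r(G) − 1`" — typed
(abc-iut-w4-d052) as `PSCDatum.CuspRank`: at every open level `U` with `r(G_U) > 0`,
`M^cusp_{G_U} = cuspFil U ⧸ closure[U,U]` is the pro-`Σ` completion of `ℤ^{r(G_U) − 1}`.
[cite: MochizukiCombGC2007, Rmk 1.3.1 p.10]

PROOF-ONLY file (abc-iut cell, layer L3, [CombGC] non-vacuity programme; seat abc-iut-w5-d195 gen 7,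
brick «SC-GENUINE-COVERING-CLOSED», part K3).  At a GENUINE smooth-curve datum `G` of type `(g, r+1)`
(profinite `Π`, one vertex `Π_v = Π`, no nodes, `ι : Γ_{g,r+1} → Π` a pro-`Σ` completion, cusp groups
conjugates of `closure ι⟨c_j⟩`), AT THE TRIVIAL LEVEL:

* `cuspFil_top_eq_unrAbKer` — `cuspFil Π = Ker(Π ↠ M^unr)` (no nodes: the cuspidal subgroups generate
  `Ker(Π ↠ Π^unr)` up to closure), `= closure ι([Γ,Γ]·⟨⟨c_j⟩⟩)` (`PSCSmoothCurveGenuineRank`);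
* `exists_cuspRank_top_of_smoothCurveGenuine` — **`M^cusp_G = cuspFil Π ⧸ closure[Π,Π]` is the pro-`Σ`
  completion of `ℤ^r`**: in `Γ_{g,r+1}^{ab} ≅ ℤ^{2g} ⊕ ℤ^{r}` (named basis,
  `PuncturedSurfaceGroup.nonempty_mulEquiv_abelianization`) the cusp classes span the summand `ℤ^r`
  (`c̄_r = −Σ_{j<r} c̄_j`), the abelianisation map `Γ^{ab} → Π ⧸ closure[Π,Π]` is a pro-`Σ` completion
  (`IsProSigmaCompletion.abelianizationMap`), pro-`Σ` completions restrict to direct summands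
  (`IsProSigmaCompletion.restrict_summand`), and the closure of the image of the cusp summand is the image
  of `cuspFil Π` in `Π^{ab}`.

The level-wise statement `CuspRank` (every open `U`: `G_U` is again a genuine smooth curve,
`restrict_smoothCurveGenuine`, transported along `map_subtype_cuspFil`) is the sequel.  0 definitions;
nothing here takes a side on [IUTchIII] Cor. 3.12.
-/

noncomputable section

namespace Literature.AnabelianGeometry.SemiGraphs

namespace PSCDatum

open scoped Pointwise
open Multiplicative
open Literature.GroupTheory.CombinatorialGroupTheory
open Literature.GroupTheory.CombinatorialGroupTheory.PuncturedSurfaceGroup (c cuspInertia IsHyperbolicType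
  nonempty_mulEquiv_abelianization)
open Literature.AnabelianGeometry.Anabelioids (IsSigmaInteger)
open SemiGraphOfAnabelioids (IsProSigmaCompletion)

universe u

variable {P : Type u} [Group P] [TopologicalSpace P] [IsTopologicalGroup P]

/-! ### `cuspFil Π = Ker(Π ↠ M^unr)` without nodes -/

/-- With no nodes, `M^cusp_G` and `M^unr`'s kernel agree at the trivial level:
`cuspFil Π = closure([Π,Π] ⊔ ⨆ γΠ_cγ⁻¹) = closure([Π,Π] ⊔ Ker(Π ↠ Π^unr))`.
[cite: MochizukiCombGC2007, Def 1.1(ii) p.7] -/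
theorem cuspFil_top_eq_unrAbKer (G : PSCDatum P) [IsEmpty G.graph.N] : G.cuspFil ⊤ = G.unrAbKer := by
  have h0 : (⋃ e', (G.nodeGp e' : Set P)) = ∅ := Set.iUnion_of_empty _
  apply le_antisymm
  · -- every cuspidal subgroup lies in `unrKer`
    unfold cuspFil unrAbKer
    refine Subgroup.topologicalClosure_minimal _ ?_ (Subgroup.isClosed_topologicalClosure _)
    refine (sup_le_sup_left (iSup_le fun A => ?_) _).trans (Subgroup.le_topologicalClosure _)
    obtain ⟨B, ⟨c₀, γ, rfl⟩, hAB⟩ := A.2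
    rw [hAB, top_inf_eq, ← (G.unrKer_normal).conjAct γ, Subgroup.pointwise_smul_le_pointwise_smul_iff]
    unfold unrKer
    exact fun x hx => Subgroup.le_topologicalClosure _
      (Subgroup.subset_normalClosure (Or.inl (Set.mem_iUnion.mpr ⟨c₀, hx⟩)))
  · -- `[Π,Π] ⊔ unrKer ≤ cuspFil Π`
    unfold unrAbKer
    refine Subgroup.topologicalClosure_minimal _ (sup_le (G.commutator_le_cuspFil ⊤) ?_)
      (Subgroup.isClosed_topologicalClosure _)
    unfold unrKer
    rw [h0, Set.union_empty]
    refine Subgroup.topologicalClosure_minimal _ ?_ (Subgroup.isClosed_topologicalClosure _)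
    unfold Subgroup.normalClosure
    rw [Subgroup.closure_le]
    intro x hx
    obtain ⟨s, hs, hconj⟩ := Group.mem_conjugatesOfSet_iff.mp hx
    obtain ⟨c₀, hsc⟩ := Set.mem_iUnion.mp hs
    obtain ⟨d, hd⟩ := isConj_iff.mp hconj
    have hA : G.IsCuspidalIn ⊤ (ConjAct.toConjAct d • G.cuspGp c₀) :=
      ⟨ConjAct.toConjAct d • G.cuspGp c₀, ⟨c₀, ConjAct.toConjAct d, rfl⟩, (top_inf_eq _).symm⟩
    have hxA : x ∈ ConjAct.toConjAct d • G.cuspGp c₀ := by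
      rw [← hd, Subgroup.mem_pointwise_smul_iff_inv_smul_mem, ← ConjAct.toConjAct_inv, ConjAct.smul_def,
        ConjAct.ofConjAct_toConjAct, inv_inv, show d⁻¹ * (d * s * d⁻¹) * d = s by group]
      exact hsc
    unfold cuspFil
    exact Subgroup.le_topologicalClosure _ (Subgroup.mem_sup_right
      (le_iSup (fun A : {A : Subgroup P // G.IsCuspidalIn ⊤ A} => (A : Subgroup P)) ⟨_, hA⟩ hxA))

/-! ### Images of closures under continuous homomorphisms of compact groups -/

/-- For a continuous homomorphism `f : Π → Q` from a compact group to a Hausdorff group,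
`f(closure S) = closure f(S)`. [cite: MochizukiCombGC2007, Rmk 1.3.1 p.10] -/
theorem map_topologicalClosure_eq [CompactSpace P] {Q : Type*} [Group Q] [TopologicalSpace Q]
    [IsTopologicalGroup Q] [T2Space Q] (f : P →* Q) (hf : Continuous f) (S : Subgroup P) :
    (S.topologicalClosure).map f = (S.map f).topologicalClosure := by
  apply le_antisymm
  · rintro _ ⟨x, hx, rfl⟩
    have h := image_closure_subset_closure_image hf ⟨x, hx, rfl⟩
    rw [← Subgroup.coe_map, ← Subgroup.topologicalClosure_coe] at h
    exact h
  · refine Subgroup.topologicalClosure_minimal _ (Subgroup.map_mono (Subgroup.le_topologicalClosure _)) ?_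
    rw [Subgroup.coe_map]
    exact ((Subgroup.isClosed_topologicalClosure S).isCompact.image hf).isClosed

/-! ### `M^cusp` at the trivial level of a genuine smooth curve with `r + 1` cusps -/

section Top

variable [CompactSpace P] [TotallyDisconnectedSpace P] (G : PSCDatum P) [IsEmpty G.graph.N] {g r : ℕ}

/-- **[CombGC] Rmk. 1.3.1, second claim, at the trivial level of a genuine smooth curve**: for `G` with
`r + 1` cusps, cusp groups conjugates of `closure ι⟨c_j⟩` (`ι : Γ_{g,r+1} → Π` a pro-`Σ` completion),
`M^cusp_G = cuspFil Π ⧸ closure[Π,Π]` is the pro-`Σ` completion of `ℤ^r = ℤ^{r(G) − 1}`.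
[cite: MochizukiCombGC2007, Rmk 1.3.1 p.10] -/
theorem exists_cuspRank_top_of_smoothCurveGenuine (ι : PuncturedSurfaceGroup g (r + 1) →* P)
    (hι : IsProSigmaCompletion G.Sigma ι) (e : G.graph.C ≃ Fin (r + 1))
    (hC : ∀ c, ∃ δ : ConjAct P,
      G.cuspGp c = δ • ((cuspInertia (g := g) (e c)).map ι).topologicalClosure)
    [hn : (((⁅(⊤ : Subgroup P), (⊤ : Subgroup P)⁆ : Subgroup P).topologicalClosure).subgroupOf
      (G.cuspFil ⊤)).Normal] :
    ∃ ιc : Multiplicative (Fin r → ℤ) →*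
        G.cuspFil ⊤ ⧸ ((⁅(⊤ : Subgroup P), (⊤ : Subgroup P)⁆ : Subgroup P).topologicalClosure).subgroupOf
          (G.cuspFil ⊤),
      IsProSigmaCompletion G.Sigma ιc := by
  classical
  -- notation: `K₀ = closure[Π,Π]`, `C = cuspFil Π`, `N = ⟨⟨c_j⟩⟩ ≤ Γ`, `X = (Fin g × Bool) ⊕ Fin r`
  set K₀ : Subgroup P := ((⁅(⊤ : Subgroup P), (⊤ : Subgroup P)⁆ : Subgroup P).topologicalClosure) with hK₀
  have hK₀c : K₀ = (commutator P).topologicalClosure := by rw [hK₀, commutator_def]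
  haveI hK₀n : K₀.Normal := by rw [hK₀c]; exact Subgroup.is_normal_topologicalClosure _
  haveI : IsClosed (K₀ : Set P) := Subgroup.isClosed_topologicalClosure _
  haveI : TotallyDisconnectedSpace (P ⧸ K₀) :=
    AbsoluteAnabelian.QuotientGroup.totallyDisconnectedSpace_of_isClosed K₀
      (Subgroup.isClosed_topologicalClosure _)
  have hA : IsProSigma G.Sigma (P ⧸ K₀) := G.proSigma.quotient K₀
  set C : Subgroup P := G.cuspFil ⊤ with hCdef
  set N : Subgroup (PuncturedSurfaceGroup g (r + 1)) := Subgroup.normalClosure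
    (⋃ j, (cuspInertia (g := g) (r := r + 1) j : Set (PuncturedSurfaceGroup g (r + 1)))) with hN
  -- the abelianisation map `ψ : Γ^{ab} → Π ⧸ K₀`, a pro-`Σ` completion
  have hcomm : commutator (PuncturedSurfaceGroup g (r + 1)) ≤ K₀.comap ι := by
    rw [hK₀c]; exact IsProSigmaCompletion.commutator_le_comap_topologicalClosure_commutator ι
  set ψ : Abelianization (PuncturedSurfaceGroup g (r + 1)) →* P ⧸ K₀ :=
    QuotientGroup.map (commutator (PuncturedSurfaceGroup g (r + 1))) K₀ ι hcomm with hψdef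
  have hψ : IsProSigmaCompletion G.Sigma ψ :=
    IsProSigmaCompletion.abelianizationMap (P := P) (hKn := by rw [← hK₀c]; exact hK₀n) hι
  have hψof : ∀ x, ψ (Abelianization.of x) = QuotientGroup.mk (ι x) := fun x => rfl
  -- the named basis of `Γ^{ab}` and the two summands
  obtain ⟨Φ, hΦa, hΦc, hΦlast⟩ := nonempty_mulEquiv_abelianization g r
  let Pinr : Subgroup (((Fin g × Bool) ⊕ Fin r) → Multiplicative ℤ) :=
    ⨅ ib : Fin g × Bool, (Pi.evalMonoidHom (fun _ => Multiplicative ℤ) (Sum.inl ib)).ker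
  let Pinl : Subgroup (((Fin g × Bool) ⊕ Fin r) → Multiplicative ℤ) :=
    ⨅ j : Fin r, (Pi.evalMonoidHom (fun _ => Multiplicative ℤ) (Sum.inr j)).ker
  have hPinr : ∀ f, f ∈ Pinr ↔ ∀ ib, f (Sum.inl ib) = 1 := fun f => by
    simp only [Pinr, Subgroup.mem_iInf, MonoidHom.mem_ker, Pi.evalMonoidHom_apply]
  have hPinl : ∀ f, f ∈ Pinl ↔ ∀ j, f (Sum.inr j) = 1 := fun f => by
    simp only [Pinl, Subgroup.mem_iInf, MonoidHom.mem_ker, Pi.evalMonoidHom_apply]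
  set L : Subgroup (Abelianization (PuncturedSurfaceGroup g (r + 1))) := N.map Abelianization.of with hL
  set L' : Subgroup (Abelianization (PuncturedSurfaceGroup g (r + 1))) := Pinl.comap Φ.toMonoidHom
    with hL'
  -- (i) the cusp classes have `Φ`-coordinates supported on `inr`
  have hΦcusp : ∀ j : Fin (r + 1), Φ (Abelianization.of (c (g := g) j)) ∈ Pinr := by
    intro j
    rw [hPinr]
    intro ib
    induction j using Fin.lastCases with
    | last =>
      rw [hΦlast, Pi.inv_apply, Finset.prod_apply]
      simp
    | cast j => rw [hΦc]; simp
  have hLle : L ≤ Pinr.comap Φ.toMonoidHom := by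
    rw [hL, Subgroup.map_le_iff_le_comap]
    refine Subgroup.normalClosure_le_normal ?_
    intro x hx
    obtain ⟨j, hj⟩ := Set.mem_iUnion.mp hx
    obtain ⟨k, rfl⟩ := Subgroup.mem_zpowers_iff.mp hj
    change Φ (Abelianization.of (c j ^ k)) ∈ Pinr
    rw [map_zpow, map_zpow]
    exact Pinr.zpow_mem (hΦcusp j) k
  -- (ii) conversely every class with coordinates supported on `inr` is a product of cusp classes
  have hbase : ∀ j : Fin r, Φ.symm (Pi.mulSingle (Sum.inr j) (ofAdd 1)) ∈ L := by
    intro j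
    rw [← hΦc, MulEquiv.symm_apply_apply, hL]
    exact Subgroup.mem_map_of_mem _ (Subgroup.subset_normalClosure
      (Set.mem_iUnion.mpr ⟨Fin.castSucc j, Subgroup.mem_zpowers _⟩))
  have hsingle : ∀ (j : Fin r) (a : Multiplicative ℤ), Φ.symm (Pi.mulSingle (Sum.inr j) a) ∈ L := by
    intro j a
    have ha : Pi.mulSingle (M := fun _ : (Fin g × Bool) ⊕ Fin r => Multiplicative ℤ) (Sum.inr j) a =
        Pi.mulSingle (Sum.inr j) (ofAdd (1 : ℤ)) ^ a.toAdd := by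
      rw [← Pi.mulSingle_zpow, ← ofAdd_zsmul, zsmul_eq_mul, mul_one, Int.cast_id, ofAdd_toAdd]
    rw [ha, map_zpow]
    exact L.zpow_mem (hbase j) _
  have hcomapLe : Pinr.comap Φ.toMonoidHom ≤ L := by
    intro x hx
    have hxP : Φ x ∈ Pinr := hx
    rw [hPinr] at hxP
    have hx' : x = ∏ s, Φ.symm (Pi.mulSingle s (Φ x s)) := by
      rw [← map_prod, Finset.univ_prod_mulSingle (Φ x), MulEquiv.symm_apply_apply]
    rw [hx']
    refine L.prod_mem fun s _ => ?_
    rcases s with ib | j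
    · rw [hxP ib, Pi.mulSingle_one, map_one]; exact L.one_mem
    · exact hsingle j _
  -- (iii) `Γ^{ab} = L ⊕ L'`
  have hinf : L ⊓ L' = ⊥ := by
    rw [eq_bot_iff]
    rintro x ⟨hxL, hxL'⟩
    have h1 : Φ x ∈ Pinr := hLle hxL
    have h2 : Φ x ∈ Pinl := hxL'
    rw [hPinr] at h1
    rw [hPinl] at h2
    have hΦx : Φ x = 1 := by
      funext s; rcases s with ib | j
      · exact h1 ib
      · exact h2 j
    rw [Subgroup.mem_bot, ← Φ.map_eq_one_iff]
    exact hΦx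
  have hsup : L ⊔ L' = ⊤ := by
    rw [eq_top_iff]
    intro x _
    let f₁ : ((Fin g × Bool) ⊕ Fin r) → Multiplicative ℤ := Sum.elim (fun _ => 1) (fun j => Φ x (Sum.inr j))
    let f₂ : ((Fin g × Bool) ⊕ Fin r) → Multiplicative ℤ := Sum.elim (fun ib => Φ x (Sum.inl ib)) (fun _ => 1)
    have hf : Φ x = f₁ * f₂ := by
      funext s; rcases s with ib | j <;> simp [f₁, f₂]
    have hx : x = Φ.symm f₁ * Φ.symm f₂ := by
      rw [← map_mul, ← hf, MulEquiv.symm_apply_apply]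
    rw [hx]
    refine Subgroup.mul_mem _ (Subgroup.mem_sup_left (hcomapLe ?_)) (Subgroup.mem_sup_right ?_)
    · change Φ (Φ.symm f₁) ∈ Pinr
      rw [MulEquiv.apply_symm_apply, hPinr]
      intro ib; rfl
    · change Φ (Φ.symm f₂) ∈ Pinl
      rw [MulEquiv.apply_symm_apply, hPinl]
      intro j; rfl
  -- (iv) pro-`Σ` completions restrict to the summand `L ≅ ℤ^r`
  have hκ := hψ.restrict_summand hA L L' hsup hinf
  set B : Subgroup (P ⧸ K₀) := (L.map ψ).topologicalClosure with hBdef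
  -- (v) `L ≅ ℤ^r`: `v ↦ Φ⁻¹(0 ⊕ v)`
  let ext : Multiplicative (Fin r → ℤ) →* (((Fin g × Bool) ⊕ Fin r) → Multiplicative ℤ) :=
    { toFun := fun v => Sum.elim (fun _ => 1) (fun j => ofAdd (v.toAdd j))
      map_one' := by funext s; rcases s with ib | j <;> rfl
      map_mul' := fun v w => by funext s; rcases s with ib | j <;> rfl }
  have hext_mem : ∀ v, ext v ∈ Pinr := fun v => by rw [hPinr]; intro ib; rfl
  have hθmem : ∀ v, Φ.symm (ext v) ∈ L := fun v =>
    hcomapLe (by change Φ (Φ.symm (ext v)) ∈ Pinr; rw [MulEquiv.apply_symm_apply]; exact hext_mem v)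
  let θ : Multiplicative (Fin r → ℤ) →* L :=
    (Φ.symm.toMonoidHom.comp ext).codRestrict L hθmem
  have hθbij : Function.Bijective θ := by
    constructor
    · intro v w hvw
      have h1 : Φ.symm (ext v) = Φ.symm (ext w) := by
        have := Subtype.ext_iff.mp hvw
        exact this
      have h2 : ext v = ext w := Φ.symm.injective h1
      apply Multiplicative.toAdd.injective
      funext j
      have := congrFun h2 (Sum.inr j)
      exact Multiplicative.ofAdd.injective this
    · rintro ⟨y, hy⟩
      have hyP : Φ y ∈ Pinr := hLle hy
      rw [hPinr] at hyP
      refine ⟨Multiplicative.ofAdd (fun j => (Φ y (Sum.inr j)).toAdd), Subtype.ext ?_⟩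
      change Φ.symm (ext _) = y
      rw [MulEquiv.symm_apply_eq]
      funext s; rcases s with ib | j
      · exact (hyP ib).symm
      · rfl
  let eL : Multiplicative (Fin r → ℤ) ≃* L := MulEquiv.ofBijective θ hθbij
  -- (vi) `closure ψ(L)` is the image of `C = cuspFil Π` in `Π ⧸ K₀`
  have hC : C = ((commutator (PuncturedSurfaceGroup g (r + 1)) ⊔ N).map ι).topologicalClosure := by
    rw [hCdef, G.cuspFil_top_eq_unrAbKer, G.unrAbKer_eq_closure_map_of_smoothCurve' ι hι e hC]
  have hB : B = C.map (QuotientGroup.mk' K₀) := by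
    rw [hBdef, hC, map_topologicalClosure_eq (QuotientGroup.mk' K₀) QuotientGroup.continuous_mk,
      Subgroup.map_sup]
    have h0 : ((commutator (PuncturedSurfaceGroup g (r + 1))).map ι).map (QuotientGroup.mk' K₀) = ⊥ := by
      rw [Subgroup.map_eq_bot_iff, QuotientGroup.ker_mk']
      exact Subgroup.map_le_iff_le_comap.mpr hcomm
    have hF : ψ.comp Abelianization.of = (QuotientGroup.mk' K₀).comp ι := MonoidHom.ext fun x => rfl
    rw [Subgroup.map_sup, h0, bot_sup_eq, hL, Subgroup.map_map, Subgroup.map_map, hF]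
  -- (vii) the target `C ⧸ K₀ ∩ C` is `C.map mk' ≅ B`, bi-continuously
  set φT : C →* P ⧸ K₀ := (QuotientGroup.mk' K₀).comp C.subtype with hφT
  have hker : φT.ker = K₀.subgroupOf C := by
    rw [hφT, ← MonoidHom.comap_ker, QuotientGroup.ker_mk']; rfl
  have hrange : φT.range = B := by rw [hφT, MonoidHom.range_comp, Subgroup.range_subtype, hB]
  let e₁ : C ⧸ K₀.subgroupOf C ≃* C ⧸ φT.ker := QuotientGroup.quotientMulEquivOfEq hker.symm
  let e₂ : C ⧸ φT.ker ≃* φT.range := QuotientGroup.quotientKerEquivRange φT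
  let e₃ : φT.range ≃* B := MulEquiv.subgroupCongr hrange
  let eT : C ⧸ K₀.subgroupOf C ≃* B := (e₁.trans e₂).trans e₃
  have heT_mk : ∀ x : C, ((eT (QuotientGroup.mk x) : B) : P ⧸ K₀) = QuotientGroup.mk (x : P) := fun _ => rfl
  haveI : CompactSpace C := isCompact_iff_compactSpace.mp
    ((hCdef ▸ Subgroup.isClosed_topologicalClosure _ : IsClosed (C : Set P))).isCompact
  have heT : Continuous eT := by
    refine (QuotientGroup.isOpenQuotientMap_mk.continuous_comp_iff).mp ?_
    refine continuous_induced_rng.2 ?_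
    have : (Subtype.val ∘ (eT ∘ QuotientGroup.mk) : C → P ⧸ K₀) =
        fun x : C => (QuotientGroup.mk (x : P) : P ⧸ K₀) := by
      funext x; exact heT_mk x
    rw [this]
    exact QuotientGroup.continuous_mk.comp continuous_subtype_val
  have heT' : Continuous eT.symm :=
    Continuous.continuous_symm_of_equiv_compact_to_t2 (f := eT.toEquiv) heT
  -- (viii) assemble: `ℤ^r ≅ L → B ≅ C ⧸ K₀ ∩ C`
  let κ : L →* B := (ψ.comp L.subtype).codRestrict B
    (fun x => IsProSigmaCompletion.apply_mem_topologicalClosure_map L x)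
  refine ⟨eT.symm.toMonoidHom.comp (κ.comp eL.toMonoidHom), ?_⟩
  have hκ' : IsProSigmaCompletion G.Sigma (κ.comp eL.toMonoidHom) :=
    IsProSigmaCompletion.of_comp_mulEquiv eL (fun _ => rfl) hκ
  exact hκ'.of_target_mulEquiv eT heT heT' fun x => eT.apply_symm_apply _

end Top

end PSCDatum

end Literature.AnabelianGeometry.SemiGraphs

end
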